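import Summits.CriticalPhenomena.PercolationContinuityZ3.Theorems.PercNearOneGluingNoHeavyLowerTailSahiClassTSingleCube
import Summits.CriticalPhenomena.PercolationContinuityZ3.Theorems.PercNearOneGluingNoHeavyLowerTailSahiCoordinateCanalyzingPeel
import Summits.CriticalPhenomena.PercolationContinuityZ3.Theorems.SahiMasterFamilyBernsteinGoodCoordinate
import Literature.Combinatorics.Sahi2008.Symmetry
import Mathlib.Tactic.Linarith
import Mathlib.Tactic.Ring
import HarnessLib

/-!
# `NoHeavyLowerTail` (crux stmt-CriticalPhenomena-4575), P2 — **THE OPEN CORE OF KAHN'S CONJECTURE 5 ON CUBES**: `C_3` for all triples of increasing events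
# ⟺ `C_3` for CORE triples — a coordinate essential to all three members, no canalyzing coordinate, no private coordinate

Support file (seat `prim-masterthm-p2`, gen 14; `--supports stmt-CriticalPhenomena-4575`).  No definition, no `sorry`, standard axioms.  SAHI-ROUTE §4.34(d)/§4.37(d).

Four inheritance mechanisms are in the tree: (i) CLASS T (`SahiClassTCube.sahiE_three_nonneg_of_classT`, this seat): no coordinate essential to all three members ⟹
`E_3 ≥ 0`; (ii) a member IMPLIED by a coordinate `x` (`{x ∈ ω} ⊆ U_j`): `C_3` of the `0`-sections suffices (`SahiCoordinateGluing.sahiE_three_nonneg_of_coordEvent_subset_member`,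
P2 gen 11); (iii) a member REQUIRING `x` (`U_j ⊆ {x ∈ ω}`): `C_3` of the `1`-sections suffices (master-conj's (A), `Pointwise.sahiE_three_interCoord_nonneg`);
(iv) a PRIVATE coordinate (essential to exactly one member): the fibre cubic has `mixC1 = 2E_3(U⁰) + E_3(U¹)`, `mixC2 = E_3(U⁰) + 2E_3(U¹)` (this file), so `C_3` of both
sections suffices (master-conj's Bernstein form `Pointwise.sahiE_three_bernstein_secAt`).  By induction on the total essential support:

* **`sahiE_three_nonneg_of_core`** — on a fixed cube and parameter: if every CORE triple (some coordinate essential to all three members; every essential coordinate is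
  essential to at least two members; no essential coordinate is canalyzing — implied or required — for a member it affects) has `E_3(μ_p; 1_U) ≥ 0`, then EVERY
  triple of increasing events has `E_3(μ_p; 1_U) ≥ 0`.
* **`masterFamilyNonneg_three_iff_core`** — `MasterFamilyNonneg 3` (⟺ `KahnConjecture`) ⟺ `C_3` on core triples.  The smallest core triples are the twisted `(2,2,2)`
  triple, the `K₄` perfect matchings and the hexagon (SAHI-ROUTE §4.32, §4.34(d)); exhaustive census: `C_3` and even the λ = 2 comb laws hold on all of `2^5`
  (ttrl mtp2 T3.md §5).
HONEST FRAMING: a reduction; `C_3` on the core remains OPEN. [this work]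
-/

noncomputable section

open scoped Classical

namespace Summit.CriticalPhenomena.PercolationContinuityZ3.Theorems

namespace SahiClassTCube

open Finset Function
open Literature.Combinatorics.Sahi2008
open Literature.Probability.Percolation.DecisionTree (ind ind_of_mem ind_of_not_mem ind_nonneg)
open Literature.Probability.LatticeModels.Kahn2022 (Affects)

variable {κ : Type} [Fintype κ]

/-! ### Small tools -/

omit [Fintype κ] in
/-- For an increasing event REQUIRING `x` (`U ⊆ {x ∈ ω}`): `U^{x←1} ∩ {x ∈ ω} = U`. [folklore] -/
theorem secAt_true_inter_coordEvent_of_subset (x : κ) {U : Set (Set κ)} (h : U ⊆ {ω : Set κ | x ∈ ω}) :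
    secAt x true U ∩ {ω : Set κ | x ∈ ω} = U := by
  ext ω
  simp only [Set.mem_inter_iff, mem_secAt, Set.mem_setOf_eq]
  constructor
  · rintro ⟨h1, hx⟩
    have : forceAt x true ω = ω := by simp [forceAt, Set.insert_eq_of_mem hx]
    rwa [this] at h1
  · intro hω
    have hx : x ∈ ω := h hω
    have : forceAt x true ω = ω := by simp [forceAt, Set.insert_eq_of_mem hx]
    rw [this]
    exact ⟨hω, hx⟩

/-- Sectioning does not increase the essential support, and removes the sectioned coordinate. [folklore] -/
theorem card_esupp_secAt_le {A : Set (Set κ)} (hA : IsUpperSet A) (x : κ) (b : Bool) :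
    (esupp (secAt x b A)).card ≤ (esupp A).card :=
  (Finset.card_le_card (esupp_secAt_subset hA x b)).trans (Finset.card_erase_le)

/-- Sectioning at an essential coordinate strictly decreases the essential support. [folklore] -/
theorem card_esupp_secAt_lt {A : Set (Set κ)} (hA : IsUpperSet A) {x : κ} (hx : x ∈ esupp A) (b : Bool) :
    (esupp (secAt x b A)).card < (esupp A).card :=
  (Finset.card_le_card (esupp_secAt_subset hA x b)).trans_lt (Finset.card_erase_lt_of_mem hx)

/-- The total essential support of the sections is smaller when `x` is essential to some member. [this work] -/
theorem sum_card_esupp_secAt_lt (U : Fin 3 → Set (Set κ)) (hU : ∀ j, IsUpperSet (U j)) {x : κ} {j : Fin 3} (hx : x ∈ esupp (U j))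
    (b : Bool) : ∑ i, (esupp (secAt x b (U i))).card < ∑ i, (esupp (U i)).card :=
  Finset.sum_lt_sum (fun i _ => card_esupp_secAt_le (hU i) x b) ⟨j, Finset.mem_univ _, card_esupp_secAt_lt (hU j) hx b⟩

/-- Re-indexing a triple by a permutation keeps `E_3` (symmetry of `E_n`). [cite: LiebSahi2021, Def. 3.1 (symmetry of `E_n`)] -/
theorem sahiE_three_ind_comp_perm (μ : Set κ → ℝ) (σ : Equiv.Perm (Fin 3)) (U : Fin 3 → Set (Set κ)) :
    sahiE μ 3 (fun i => ind (U (σ i))) = sahiE μ 3 (fun i => ind (U i)) :=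
  sahiE_comp_perm μ 3 σ (fun i => ind (U i))

omit [Fintype κ] in
/-- The vector `![V 0, V 1, V 2]` is `V`. [folklore] -/
theorem vec3_eta (V : Fin 3 → Set (Set κ)) : (![V 0, V 1, V 2] : Fin 3 → Set (Set κ)) = V := by
  funext i; fin_cases i <;> rfl

/-- **Private coordinate: the two mixed Bernstein coefficients are `2E_3(U⁰) + E_3(U¹)` and `E_3(U⁰) + 2E_3(U¹)`** when the members `1, 2` have equal sections
(the fibre is affine). [this work] -/
theorem mixC_eq_of_sections_eq (μ : Set κ → ℝ) (P Q : Fin 3 → Set (Set κ)) (h1 : Q 1 = P 1) (h2 : Q 2 = P 2) :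
    SahiCombMix.mixC1 μ P Q = 2 * sahiE μ 3 (fun j => ind (P j)) + sahiE μ 3 (fun j => ind (Q j)) ∧
      SahiCombMix.mixC2 μ P Q = sahiE μ 3 (fun j => ind (P j)) + 2 * sahiE μ 3 (fun j => ind (Q j)) := by
  rw [SahiCombMix.mixC1, SahiCombMix.mixC2, sahiE_three_apply, sahiE_three_apply, h1, h2]
  constructor <;> ring

/-! ### The reduction on a fixed cube -/

/-- **`C_3` from `C_3` on CORE triples** (fixed cube `κ`, fixed parameter `p`).  CORE: some coordinate is essential to all three members; no essential coordinate is
implied (`{x∈ω} ⊆ U_j`) or required (`U_j ⊆ {x∈ω}`) for a member it is essential to; every essential coordinate is essential to at least two members. [this work] -/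
theorem sahiE_three_nonneg_of_core (p : κ → unitInterval)
    (hcore : ∀ U : Fin 3 → Set (Set κ), (∀ j, IsUpperSet (U j)) →
      (∃ x, x ∈ esupp (U 0) ∧ x ∈ esupp (U 1) ∧ x ∈ esupp (U 2)) →
      (∀ j x, x ∈ esupp (U j) → ¬ ({ω : Set κ | x ∈ ω} ⊆ U j) ∧ ¬ (U j ⊆ {ω : Set κ | x ∈ ω})) →
      (∀ j x, x ∈ esupp (U j) → ∃ j', j' ≠ j ∧ x ∈ esupp (U j')) →
      0 ≤ sahiE (bernoulliWeight p) 3 (fun j => ind (U j)))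
    (U : Fin 3 → Set (Set κ)) (hU : ∀ j, IsUpperSet (U j)) :
    0 ≤ sahiE (bernoulliWeight p) 3 (fun j => ind (U j)) := by
  suffices key : ∀ (N : ℕ) (V : Fin 3 → Set (Set κ)), (∑ i, (esupp (V i)).card) ≤ N → (∀ j, IsUpperSet (V j)) →
      0 ≤ sahiE (bernoulliWeight p) 3 (fun j => ind (V j)) from key _ U le_rfl hU
  intro N
  induction N with
  | zero =>
    -- no essential coordinates at all: class T
    intro V hN hV
    refine sahiE_three_nonneg_of_classT' V hV (fun x hx => ?_) p
    have h0 : (esupp (V 0)).card = 0 := by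
      have := Finset.single_le_sum (f := fun i => (esupp (V i)).card) (fun i _ => Nat.zero_le _) (Finset.mem_univ (0 : Fin 3))
      omega
    rw [Finset.card_eq_zero] at h0
    simpa [h0] using hx.1
  | succ N ih =>
    intro V hN hV
    -- sections and their support
    have hVsec : ∀ (x : κ) (b : Bool) (j : Fin 3), IsUpperSet (secAt x b (V j)) := fun x b j => isUpperSet_secAt x b (hV j)
    have ihsec : ∀ (x : κ) (b : Bool) (j : Fin 3), x ∈ esupp (V j) →
        0 ≤ sahiE (bernoulliWeight p) 3 (fun i => ind (secAt x b (V i))) := by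
      intro x b j hx
      refine ih (fun i => secAt x b (V i)) ?_ (hVsec x b)
      have := sum_card_esupp_secAt_lt V hV hx b
      omega
    -- the same for a re-indexed triple
    have ihsecσ : ∀ (σ : Equiv.Perm (Fin 3)) (x : κ) (b : Bool) (j : Fin 3), x ∈ esupp (V (σ j)) →
        0 ≤ sahiE (bernoulliWeight p) 3 (fun i => ind (secAt x b (V (σ i)))) := by
      intro σ x b j hx
      rw [sahiE_three_ind_comp_perm (bernoulliWeight p) σ (fun i => secAt x b (V i))]
      exact ihsec x b (σ j) hx
    by_cases hT : ∃ x, x ∈ esupp (V 0) ∧ x ∈ esupp (V 1) ∧ x ∈ esupp (V 2)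
    swap
    · -- class T
      push Not at hT
      exact sahiE_three_nonneg_of_classT' V hV (fun x hx => hT x hx.1 hx.2.1 hx.2.2) p
    by_cases himp : ∃ (j : Fin 3) (x : κ), x ∈ esupp (V j) ∧ {ω : Set κ | x ∈ ω} ⊆ V j
    · -- an implied coordinate: inherit from the `0`-sections
      obtain ⟨j, x, hx, hsub⟩ := himp
      let σ : Equiv.Perm (Fin 3) := Equiv.swap 0 j
      have hσ : σ 0 = j := by simp [σ]
      rw [← sahiE_three_ind_comp_perm (bernoulliWeight p) σ V]
      have h := SahiCoordinateGluing.sahiE_three_nonneg_of_coordEvent_subset_member p x (hV (σ 0)) (hV (σ 1)) (hV (σ 2))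
        (by rw [hσ]; exact hsub) (by
          rw [Pointwise.ind_vec3, ← Pointwise.ind_vec3, vec3_eta (fun i => secAt x false (V (σ i)))]
          exact ihsecσ σ x false 0 (by rw [hσ]; exact hx))
      rw [vec3_eta (fun i => V (σ i))] at h
      exact h
    by_cases hreq : ∃ (j : Fin 3) (x : κ), x ∈ esupp (V j) ∧ V j ⊆ {ω : Set κ | x ∈ ω}
    · -- a required coordinate: inherit from the `1`-sections
      obtain ⟨j, x, hx, hsub⟩ := hreq
      let σ : Equiv.Perm (Fin 3) := Equiv.swap 2 j
      have hσ : σ 2 = j := by simp [σ]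
      rw [← sahiE_three_ind_comp_perm (bernoulliWeight p) σ V]
      have hCe : ∀ b : Bool, secAt x b (secAt x true (V (σ 2))) = secAt x true (V (σ 2)) := fun b => Pointwise.secAt_secAt_same x b true _
      have h := Pointwise.sahiE_three_interCoord_nonneg p x (hV (σ 0)) (hV (σ 1)) (hVsec x true (σ 2)) hCe (by
        rw [Pointwise.ind_vec3, ← Pointwise.ind_vec3, vec3_eta (fun i => secAt x true (V (σ i)))]
        exact ihsecσ σ x true 2 (by rw [hσ]; exact hx))
      rw [secAt_true_inter_coordEvent_of_subset x (by rw [hσ]; exact hsub), vec3_eta (fun i => V (σ i))] at h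
      exact h
    by_cases hpriv : ∃ (j : Fin 3) (x : κ), x ∈ esupp (V j) ∧ ∀ j', j' ≠ j → x ∉ esupp (V j')
    · -- a private coordinate: the fibre is affine, both sections are smaller
      obtain ⟨j, x, hx, hnot⟩ := hpriv
      let σ : Equiv.Perm (Fin 3) := Equiv.swap 0 j
      have hσ : σ 0 = j := by simp [σ]
      rw [← sahiE_three_ind_comp_perm (bernoulliWeight p) σ V]
      have hVσ : ∀ i, IsUpperSet (V (σ i)) := fun i => hV (σ i)
      rw [Pointwise.sahiE_three_bernstein_secAt x (fun i => V (σ i)) hVσ p]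
      have hfree : ∀ i : Fin 3, i ≠ 0 → ∀ b : Bool, secAt x b (V (σ i)) = V (σ i) := by
        intro i hi b
        have hne : σ i ≠ j := by
          intro h'
          apply hi
          have : σ i = σ 0 := by rw [h', hσ]
          exact σ.injective this
        exact secAt_eq_self_of_not_affects (hV (σ i)) (fun ha => hnot (σ i) hne (mem_esupp.2 ha)) b
      have h1 : secAt x true (V (σ 1)) = secAt x false (V (σ 1)) := by rw [hfree 1 (by decide), hfree 1 (by decide)]
      have h2 : secAt x true (V (σ 2)) = secAt x false (V (σ 2)) := by rw [hfree 2 (by decide), hfree 2 (by decide)]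
      obtain ⟨e1, e2⟩ := mixC_eq_of_sections_eq (bernoulliWeight p) (fun i => secAt x false (V (σ i))) (fun i => secAt x true (V (σ i))) h1 h2
      rw [e1, e2]
      have E0 := ihsecσ σ x false 0 (by rw [hσ]; exact hx)
      have E1 := ihsecσ σ x true 0 (by rw [hσ]; exact hx)
      have ht0 : 0 ≤ (p x : ℝ) := (p x).2.1
      have ht1 : 0 ≤ 1 - (p x : ℝ) := sub_nonneg.2 (p x).2.2
      have hm1 : 0 ≤ 2 * sahiE (bernoulliWeight p) 3 (fun i => ind (secAt x false (V (σ i))))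
          + sahiE (bernoulliWeight p) 3 (fun i => ind (secAt x true (V (σ i)))) := by linarith
      have hm2 : 0 ≤ sahiE (bernoulliWeight p) 3 (fun i => ind (secAt x false (V (σ i))))
          + 2 * sahiE (bernoulliWeight p) 3 (fun i => ind (secAt x true (V (σ i)))) := by linarith
      have a0 := mul_nonneg (pow_nonneg ht1 3) E0
      have a1 := mul_nonneg (mul_nonneg ht0 (pow_nonneg ht1 2)) hm1
      have a2 := mul_nonneg (mul_nonneg (pow_nonneg ht0 2) ht1) hm2
      have a3 := mul_nonneg (pow_nonneg ht0 3) E1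
      linarith
    -- otherwise the triple is CORE
    push Not at himp hreq hpriv
    exact hcore V hV hT (fun j x hx => ⟨himp j x hx, hreq j x hx⟩) (fun j x hx => by
      obtain ⟨j', hj', hxj'⟩ := hpriv j x hx
      exact ⟨j', hj', by simpa using hxj'⟩)

/-- **THE OPEN CORE.**  Kahn's Conjecture 5 / Sahi's `C_3` on product measures holds for all triples of increasing events iff it holds for the CORE triples
(a coordinate essential to all three members; no canalyzing essential coordinate; no private essential coordinate). [this work] -/
theorem masterFamilyNonneg_three_iff_core :
    MasterFamilyNonneg 3 ↔
      ∀ (κ : Type) [Fintype κ] (p : κ → unitInterval) (U : Fin 3 → Set (Set κ)), (∀ j, IsUpperSet (U j)) →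
        (∃ x, x ∈ esupp (U 0) ∧ x ∈ esupp (U 1) ∧ x ∈ esupp (U 2)) →
        (∀ j x, x ∈ esupp (U j) → ¬ ({ω : Set κ | x ∈ ω} ⊆ U j) ∧ ¬ (U j ⊆ {ω : Set κ | x ∈ ω})) →
        (∀ j x, x ∈ esupp (U j) → ∃ j', j' ≠ j ∧ x ∈ esupp (U j')) →
        0 ≤ sahiE (bernoulliWeight p) 3 (fun j => ind (U j)) := by
  constructor
  · intro h κ _ p U hU _ _ _
    exact h κ p U hU
  · intro h κ _ p U hU
    exact sahiE_three_nonneg_of_core p (fun V hV h1 h2 h3 => h κ p V hV h1 h2 h3) U hU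

end SahiClassTCube

end Summit.CriticalPhenomena.PercolationContinuityZ3.Theorems
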